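import Mathlib
import Literature.Analysis.FluidPDE.ClassicalSolution
import Literature.Analysis.FluidPDE.LerayHopf
import Literature.Analysis.FluidPDE.NSWave0
import Literature.Analysis.FluidPDE.TaoLocalisation
import Summits.NavierStokesRegularity.NavierStokesRegularity.Theses.L3TimeExponentPincer
import Summits.NavierStokesRegularity.NavierStokesRegularity.Theorems.L3TimeExponentPincerEffNode
import Summits.NavierStokesRegularity.NavierStokesRegularity.Theorems.L3TimeExponentPincerSmoothBranch
import Summits.NavierStokesRegularity.NavierStokesRegularity.Theorems.L3TimeExponentPincerJawFullMorrey
import Summits.NavierStokesRegularity.NavierStokesRegularity.Theorems.L3TimeExponentPincerDissipationAxis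
import HarnessLib

/-!
# Phase-space localisation of crux `L3CascadeJaw` (stmt-NavierStokesRegularity-19499): the jaw lives on
# the super-Euler-speed set

Support file for the PARENT crux `L3CascadeJaw` of route `L3TimeExponentPincer` (cell ns-regularity-ideate,
seat ns-pincer-19499-p1 g2).  The crux asks, for every `q ∈ (4,5)` and every frame solution (classical on
`[0,T)`, Leray–Hopf from a rapidly decaying datum), for a final window with `∫_{T₂}^T ‖u(t)‖_{L³}^q dt < ∞`
("the clause at `q`").  The route's mechanism story is the EULER-SPEED LAW `|u| ≲ (T-t)^{-3/5}` of a complete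
cascade (birth stub `stub_supEulerSpeedLaw`); this file proves that the crux is EXACTLY a statement about the
fluid that violates that law.  Split `|u|³ = |u|³·𝟙_{|u| ≤ λ} + |u|³·𝟙_{|u| > λ}` at the Euler-speed level
`λ(t) = K (T-t)^{-3/5}`: the sub-Euler fluid contributes at most `λ(t)·∫|u(t)|² ≤ 2E₀K (T-t)^{-3/5}` to
`‖u(t)‖₃³`, i.e. `(2E₀K)^{q/3}(T-t)^{-q/5}` to `‖u(t)‖₃^q` — integrable at `T` iff `q < 5`, which is the whole
jaw window.  Hence (all unconditional, kernel-checked):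

* `lintegral_enorm_cube_le_split_level` — the one-time split `∫|v|³ ≤ λ∫|v|² + ∫_{|v|>λ}|v|³`;
* `jawClauseAt_iff_superEuler` — for every frame solution, every `K ≥ 0`, every threshold exponent
  `θ ≤ 3/5` and every `0 ≤ q < 5`: the clause at `q` ⟺ the clause at `q` for the `L³`-mass of the set
  `{x : |u(t,x)| > K (T-t)^{-θ}}` (the threshold `θ = 3/5` gives the SMALLEST such set at energy level: for
  `θ > 3/5` the sub-threshold fluid alone may break the clause near `q = 5`);
* `l3CascadeJaw_iff_superEuler` — the crux BY NAME ⟺ "for every frame solution the `L³`-mass of the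
  super-Euler-speed set `{|u(t,·)| > K (T-t)^{-3/5}}` is `L^{q/3}`-integrable in time up to `T` for every
  `q < 5`" (any fixed `K > 0`);
* `volume_superEuler_le` — Chebyshev: that set has volume `≤ (2E₀/K²)(T-t)^{6/5}`, i.e. it fits (in measure)
  into `O(1)` balls of the Euler-eddy radius `r_E ∼ (T-t)^{2/5}` — the crux is decided on an Euler-eddy-sized
  portion of space;
* `jawClauseAt_of_supEulerSpeedLaw`, `l3CascadeJaw_of_supEulerSpeedLaw_blowup` — if the super-Euler set is
  empty near `T` (the sup-norm Euler-speed law `|u(t,x)| ≤ K (T-t)^{-3/5}`, birth stub `stub_supEulerSpeedLaw`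
  on the blow-up branch) the clause holds for every `q < 5`; so "sup Euler-speed law on blow-ups ⇒
  `L3CascadeJaw`" BY NAME (the birth line's composition `stub_supRateToL3Rate`, now a tree theorem);
* `setLIntegral_cube_le_rpow_mul_setLIntegral_rpow`, `jawClauseAt_of_weightedLp` — the `p`-family: on the
  super-Euler set `|u|³ ≤ λ^{3-p}|u|^p` (`p ≥ 3`), so `∫_{T₂}^T ((T-t)^{3(p-3)/5} ‖u(t)‖_p^p)^{q/3} dt < ∞`
  for all `q < 5` implies the clause (Euler-weighted `L^p` currencies; `p = ∞` is the sup law, `p = 6` with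
  Sobolev is the dissipation axis `δ ≲ (T-t)^{-4/5+}` of `L3TimeExponentPincerDissipationAxis`).

Numbers: threshold speed exponent `3/5` (sharp at energy level) · super-Euler volume exponent `6/5 = 3·(2/5)`
· time weight `(T-t)^{-q/5}` integrable iff `q < 5`.

WHAT THIS IS NOT: not a claim about Navier–Stokes regularity or blow-up and no progress on the crux's open
content (whether true NS blow-ups carry jaw-breaking super-Euler fluid); a reformulation landed
`--supports stmt-NavierStokesRegularity-19499`.
-/

noncomputable section

namespace Summit.NavierStokesRegularity.NavierStokesRegularity.Theorems.L3TimeExponentPincerJawSuperEuler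

open MeasureTheory Set Function Filter Topology
open scoped ENNReal NNReal
open Literature.Analysis.FluidPDE
open Summit.NavierStokesRegularity.NavierStokesRegularity.Theses.L3TimeExponentPincer (L3CascadeJaw)
open Summit.NavierStokesRegularity.NavierStokesRegularity.Theorems.L3TimeExponentPincerEffNode
  (lintegral_Ioo_ofReal_mul_rpow_lt_top JawBlowupBranch)
open Summit.NavierStokesRegularity.NavierStokesRegularity.Theorems.L3TimeExponentPincerSmoothBranch
  (l3CascadeJaw_iff_blowupBranch)
open Summit.NavierStokesRegularity.NavierStokesRegularity.Theorems.L3TimeExponentPincerJawFullMorrey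
  (eLpNorm_three_rpow_eq measurable_velocity)
open Summit.NavierStokesRegularity.NavierStokesRegularity.Theorems.L3TimeExponentPincerDissipationAxis
  (add_rpow_le_two_rpow)

/-! ## §1  One time slice: the split at a level `λ` -/

/-- Pointwise split of `|v|³` at level `λ ≥ 0`: `|v(x)|³ ≤ λ|v(x)|² + 𝟙_{|v|>λ}(x)|v(x)|³`. -/
theorem enorm_cube_le_split_level (v : EuclideanSpace ℝ (Fin 3) → EuclideanSpace ℝ (Fin 3)) (l : ℝ)
    (x : EuclideanSpace ℝ (Fin 3)) :
    ‖v x‖ₑ ^ 3 ≤ ENNReal.ofReal l * ‖v x‖ₑ ^ 2 + {y | l < ‖v y‖}.indicator (fun y => ‖v y‖ₑ ^ 3) x := by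
  by_cases hx : l < ‖v x‖
  · rw [indicator_of_mem (show x ∈ {y | l < ‖v y‖} from hx)]
    exact le_add_self
  · rw [indicator_of_notMem (show x ∉ {y | l < ‖v y‖} from hx), add_zero, pow_succ']
    gcongr
    rw [← ofReal_norm]
    exact ENNReal.ofReal_le_ofReal (not_lt.1 hx)

/-- **The one-time split** `∫|v|³ ≤ λ ∫|v|² + ∫_{|v|>λ} |v|³` (`λ ≥ 0`, `v` measurable). [folklore] -/
theorem lintegral_enorm_cube_le_split_level {v : EuclideanSpace ℝ (Fin 3) → EuclideanSpace ℝ (Fin 3)}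
    (hv : Measurable v) (l : ℝ) :
    ∫⁻ x, ‖v x‖ₑ ^ 3 ≤ ENNReal.ofReal l * (∫⁻ x, ‖v x‖ₑ ^ 2) + ∫⁻ x in {y | l < ‖v y‖}, ‖v x‖ₑ ^ 3 := by
  have hmeas : Measurable fun x => ENNReal.ofReal l * ‖v x‖ₑ ^ 2 :=
    (hv.enorm.pow_const 2).const_mul _
  calc ∫⁻ x, ‖v x‖ₑ ^ 3
      ≤ ∫⁻ x, (ENNReal.ofReal l * ‖v x‖ₑ ^ 2 + {y | l < ‖v y‖}.indicator (fun y => ‖v y‖ₑ ^ 3) x) :=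
        lintegral_mono fun x => enorm_cube_le_split_level v l x
    _ = ENNReal.ofReal l * (∫⁻ x, ‖v x‖ₑ ^ 2) + ∫⁻ x, {y | l < ‖v y‖}.indicator (fun y => ‖v y‖ₑ ^ 3) x := by
        rw [lintegral_add_left hmeas, lintegral_const_mul _ (hv.enorm.pow_const 2)]
    _ ≤ ENNReal.ofReal l * (∫⁻ x, ‖v x‖ₑ ^ 2) + ∫⁻ x in {y | l < ‖v y‖}, ‖v x‖ₑ ^ 3 :=
        add_le_add_right (lintegral_indicator_le _ _) _

/-- The super-level part never exceeds the whole: `∫_{|v|>λ}|v|³ ≤ ∫|v|³ = ‖v‖₃³`. -/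
theorem setLIntegral_enorm_cube_le (v : EuclideanSpace ℝ (Fin 3) → EuclideanSpace ℝ (Fin 3)) (s : Set (EuclideanSpace ℝ (Fin 3))) :
    ∫⁻ x in s, ‖v x‖ₑ ^ 3 ≤ ∫⁻ x, ‖v x‖ₑ ^ 3 :=
  setLIntegral_le_lintegral _ _

/-- **`p`-family on the super-level set**: for `p ≥ 3` and `λ > 0`, `|v|³ ≤ λ^{3-p} |v|^p` on `{|v| > λ}`, hence
`∫_{|v|>λ}|v|³ ≤ λ^{3-p} ∫_{|v|>λ}|v|^p`. [folklore] -/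
theorem setLIntegral_cube_le_rpow_mul_setLIntegral_rpow {v : EuclideanSpace ℝ (Fin 3) → EuclideanSpace ℝ (Fin 3)}
    (hv : Measurable v) {l : ℝ} (hl : 0 < l) {p : ℝ} (hp : 3 ≤ p) :
    ∫⁻ x in {y | l < ‖v y‖}, ‖v x‖ₑ ^ 3 ≤
      ENNReal.ofReal (l ^ (3 - p)) * ∫⁻ x in {y | l < ‖v y‖}, ‖v x‖ₑ ^ p := by
  have hset : MeasurableSet {y | l < ‖v y‖} := measurableSet_lt measurable_const hv.norm
  rw [← lintegral_const_mul _ (hv.enorm.pow_const p)]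
  refine setLIntegral_mono' hset fun x hx => ?_
  have hx' : l < ‖v x‖ := hx
  have hxpos : 0 < ‖v x‖ := hl.trans hx'
  have hxe : ‖v x‖ₑ = ENNReal.ofReal ‖v x‖ := (ofReal_norm (v x)).symm
  have h3 : ‖v x‖ₑ ^ 3 = ‖v x‖ₑ ^ (3 - p) * ‖v x‖ₑ ^ p := by
    rw [← ENNReal.rpow_add _ _ (by rw [hxe]; exact ENNReal.ofReal_pos.2 hxpos |>.ne')
      (by rw [hxe]; exact ENNReal.ofReal_ne_top)]
    norm_num
  rw [h3]
  gcongr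
  rw [hxe, ENNReal.ofReal_rpow_of_pos hxpos]
  exact ENNReal.ofReal_le_ofReal (Real.rpow_le_rpow_of_nonpos hl hx'.le (by linarith))

/-! ## §2  The frame: energy bound and the Euler-speed threshold `λ(t) = K (T-t)^{-θ}` -/

/-- Chebyshev at the Euler-speed level: for a frame solution and `t ∈ [0,T)`, `K > 0`,
`|{x : |u(t,x)| > K (T-t)^{-3/5}}| ≤ (2E₀/K²)·(T-t)^{6/5}` — the super-Euler-speed set has the volume of
`O(1)` Euler eddies (`r_E ∼ (T-t)^{2/5}`). [folklore] -/
theorem volume_superEuler_le {ν T : ℝ} (hν : 0 < ν)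
    {u : ℝ → EuclideanSpace ℝ (Fin 3) → EuclideanSpace ℝ (Fin 3)} {p : ℝ → EuclideanSpace ℝ (Fin 3) → ℝ}
    (hcl : IsClassicalNSSolutionOn (Ico 0 T) ν 0 u p) (hLH : IsLerayHopfOn T ν 0 (u 0) u)
    {K : ℝ} (hK : 0 < K) {t : ℝ} (ht : t ∈ Ico 0 T) :
    volume {x | K * (T - t) ^ (-(3 / 5 : ℝ)) < ‖u t x‖} ≤
      ENNReal.ofReal (2 * VectorCalculus.kineticEnergy (u 0) / K ^ 2 * (T - t) ^ (6 / 5 : ℝ)) := by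
  have hs : 0 < T - t := sub_pos.2 ht.2
  set l : ℝ := K * (T - t) ^ (-(3 / 5 : ℝ)) with hl
  have hlpos : 0 < l := mul_pos hK (Real.rpow_pos_of_pos hs _)
  have hmeas : AEMeasurable (fun x => ‖u t x‖ₑ ^ 2) volume :=
    ((measurable_velocity hcl ht).enorm.pow_const 2).aemeasurable
  have hE := hLH.lintegral_enorm_sq_le hν.le (Ico_subset_Icc_self ht)
  have hsub : {x | l < ‖u t x‖} ⊆ {x | ENNReal.ofReal (l ^ 2) ≤ ‖u t x‖ₑ ^ 2} := by
    intro x hx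
    have hx' : l < ‖u t x‖ := hx
    show ENNReal.ofReal (l ^ 2) ≤ ‖u t x‖ₑ ^ 2
    rw [← ofReal_norm, ← ENNReal.ofReal_pow (norm_nonneg _)]
    exact ENNReal.ofReal_le_ofReal (pow_le_pow_left₀ hlpos.le hx'.le 2)
  have hl2 : 0 < l ^ 2 := pow_pos hlpos 2
  calc volume {x | l < ‖u t x‖}
      ≤ volume {x | ENNReal.ofReal (l ^ 2) ≤ ‖u t x‖ₑ ^ 2} := measure_mono hsub
    _ ≤ (∫⁻ x, ‖u t x‖ₑ ^ 2) / ENNReal.ofReal (l ^ 2) :=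
        meas_ge_le_lintegral_div hmeas (ENNReal.ofReal_pos.2 hl2).ne' ENNReal.ofReal_ne_top
    _ ≤ ENNReal.ofReal (2 * VectorCalculus.kineticEnergy (u 0)) / ENNReal.ofReal (l ^ 2) := by
        gcongr
    _ = ENNReal.ofReal (2 * VectorCalculus.kineticEnergy (u 0) / l ^ 2) :=
        (ENNReal.ofReal_div_of_pos hl2).symm
    _ = ENNReal.ofReal (2 * VectorCalculus.kineticEnergy (u 0) / K ^ 2 * (T - t) ^ (6 / 5 : ℝ)) := by
        congr 1
        have h65 : ((T - t) ^ (-(3 / 5 : ℝ))) ^ 2 = ((T - t) ^ (6 / 5 : ℝ))⁻¹ := by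
          rw [← Real.rpow_natCast, ← Real.rpow_mul hs.le, ← Real.rpow_neg hs.le]
          norm_num
        rw [hl, mul_pow, h65]
        field_simp

/-- The sub-threshold fluid: at a time `t ∈ [0,T)` of a frame solution, for `K ≥ 0` and any `θ`,
`‖u(t)‖₃³ ≤ 2E₀K (T-t)^{-θ} + ∫_{|u(t)|> K(T-t)^{-θ}} |u(t)|³`. -/
theorem l3cube_le_low_add_super {ν T : ℝ} (hν : 0 < ν)
    {u : ℝ → EuclideanSpace ℝ (Fin 3) → EuclideanSpace ℝ (Fin 3)} {p : ℝ → EuclideanSpace ℝ (Fin 3) → ℝ}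
    (hcl : IsClassicalNSSolutionOn (Ico 0 T) ν 0 u p) (hLH : IsLerayHopfOn T ν 0 (u 0) u)
    {K : ℝ} (hK : 0 ≤ K) (θ : ℝ) {t : ℝ} (ht : t ∈ Ico 0 T) :
    ∫⁻ x, ‖u t x‖ₑ ^ 3 ≤
      ENNReal.ofReal (2 * VectorCalculus.kineticEnergy (u 0) * K * (T - t) ^ (-θ)) +
        ∫⁻ x in {y | K * (T - t) ^ (-θ) < ‖u t y‖}, ‖u t x‖ₑ ^ 3 := by
  have hs : 0 < T - t := sub_pos.2 ht.2
  have hl : 0 ≤ K * (T - t) ^ (-θ) := mul_nonneg hK (Real.rpow_nonneg hs.le _)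
  have hE := hLH.lintegral_enorm_sq_le hν.le (Ico_subset_Icc_self ht)
  calc ∫⁻ x, ‖u t x‖ₑ ^ 3
      ≤ ENNReal.ofReal (K * (T - t) ^ (-θ)) * (∫⁻ x, ‖u t x‖ₑ ^ 2) +
          ∫⁻ x in {y | K * (T - t) ^ (-θ) < ‖u t y‖}, ‖u t x‖ₑ ^ 3 :=
        lintegral_enorm_cube_le_split_level (measurable_velocity hcl ht) _
    _ ≤ ENNReal.ofReal (K * (T - t) ^ (-θ)) * ENNReal.ofReal (2 * VectorCalculus.kineticEnergy (u 0)) +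
          ∫⁻ x in {y | K * (T - t) ^ (-θ) < ‖u t y‖}, ‖u t x‖ₑ ^ 3 :=
        by gcongr
    _ = _ := by
        rw [← ENNReal.ofReal_mul hl]
        congr 2
        ring

/-- Time integrability of the sub-threshold contribution: for `θ ≤ 3/5`, `0 ≤ q < 5` and any `c`,
`∫_{T₂}^T (c (T-t)^{-θ})^{q/3} dt < ∞` — here in the form `∫ ofReal(c' (T-t)^{-θ q/3}) < ∞`, `θq/3 < 1`. -/
theorem lintegral_low_rpow_lt_top {T₂ T c θ q : ℝ} (hT₂ : T₂ < T) (hθ : θ ≤ 3 / 5) (hq0 : 0 ≤ q) (hq5 : q < 5) :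
    ∫⁻ t in Ioo T₂ T, ENNReal.ofReal (c * (T - t) ^ (-(θ * (q / 3)))) < ⊤ := by
  refine lintegral_Ioo_ofReal_mul_rpow_lt_top hT₂ c _ ?_
  have : θ * (q / 3) < 1 := by
    rcases le_or_gt 0 θ with hθ0 | hθ0
    · calc θ * (q / 3) ≤ 3 / 5 * (q / 3) := by gcongr
        _ < 1 := by linarith
    · calc θ * (q / 3) ≤ 0 := mul_nonpos_of_nonpos_of_nonneg hθ0.le (by linarith)
        _ < 1 := one_pos
  linarith

/-! ## §3  The clause ⟺ the clause on the super-threshold set (every frame solution, every `q < 5`) -/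

/-- **Phase-space localisation of the clause.**  For a frame solution, `K ≥ 0`, a threshold exponent
`θ ≤ 3/5` and `0 ≤ q < 5`: `∫_{T₂}^T ‖u(t)‖₃^q dt < ∞` on some final window ⟺
`∫_{T₂}^T (∫_{|u(t,x)| > K(T-t)^{-θ}} |u(t,x)|³ dx)^{q/3} dt < ∞` on some final window.  (⇒: monotonicity;
⇐: the sub-threshold fluid contributes `≤ (2E₀K)^{q/3}(T-t)^{-θq/3}`, integrable since `θq/3 ≤ q/5 < 1`.) -/
theorem jawClauseAt_iff_superEuler {ν T : ℝ} (hν : 0 < ν)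
    {u : ℝ → EuclideanSpace ℝ (Fin 3) → EuclideanSpace ℝ (Fin 3)} {p : ℝ → EuclideanSpace ℝ (Fin 3) → ℝ}
    (hcl : IsClassicalNSSolutionOn (Ico 0 T) ν 0 u p) (hLH : IsLerayHopfOn T ν 0 (u 0) u)
    {K : ℝ} (hK : 0 ≤ K) {θ : ℝ} (hθ : θ ≤ 3 / 5) {q : ℝ} (hq0 : 0 ≤ q) (hq5 : q < 5) :
    (∃ T₂ ∈ Ioo 0 T, (∫⁻ t in Ioo T₂ T, eLpNorm (u t) 3 volume ^ q) < ⊤) ↔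
      ∃ T₂ ∈ Ioo 0 T, (∫⁻ t in Ioo T₂ T,
        (∫⁻ x in {y | K * (T - t) ^ (-θ) < ‖u t y‖}, ‖u t x‖ₑ ^ 3) ^ (q / 3)) < ⊤ := by
  have hq3 : 0 ≤ q / 3 := by positivity
  constructor
  · rintro ⟨T₂, hT₂, hfin⟩
    refine ⟨T₂, hT₂, lt_of_le_of_lt (lintegral_mono fun t => ?_) hfin⟩
    rw [eLpNorm_three_rpow_eq]
    exact ENNReal.rpow_le_rpow (setLIntegral_enorm_cube_le _ _) hq3
  · rintro ⟨T₂, hT₂, hfin⟩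
    refine ⟨T₂, hT₂, ?_⟩
    set E₀ : ℝ := VectorCalculus.kineticEnergy (u 0) with hE₀
    -- the sub-threshold majorant, as a measurable function of time
    set low : ℝ → ℝ≥0∞ := fun t =>
      ENNReal.ofReal ((2 * E₀ * K) ^ (q / 3) * (T - t) ^ (-(θ * (q / 3)))) with hlow
    have hlow_meas : Measurable low := by
      rw [hlow]
      exact (measurable_const.mul ((measurable_const.sub measurable_id).pow_const _)).ennreal_ofReal
    set high : ℝ → ℝ≥0∞ := fun t =>
      (∫⁻ x in {y | K * (T - t) ^ (-θ) < ‖u t y‖}, ‖u t x‖ₑ ^ 3) ^ (q / 3) with hhigh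
    -- pointwise bound on the window
    have hpt : ∀ t ∈ Ioo T₂ T, eLpNorm (u t) 3 volume ^ q ≤ (2 : ℝ≥0∞) ^ (q / 3) * (low t + high t) := by
      intro t ht
      have ht' : t ∈ Ico 0 T := ⟨(hT₂.1.trans ht.1).le, ht.2⟩
      have hs : 0 < T - t := sub_pos.2 ht.2
      have h2EK : 0 ≤ 2 * E₀ * K := by
        have : 0 ≤ E₀ := by rw [hE₀]; exact kineticEnergy_nonneg _
        positivity
      rw [eLpNorm_three_rpow_eq]
      calc (∫⁻ x, ‖u t x‖ₑ ^ 3) ^ (q / 3)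
          ≤ (ENNReal.ofReal (2 * E₀ * K * (T - t) ^ (-θ)) +
              ∫⁻ x in {y | K * (T - t) ^ (-θ) < ‖u t y‖}, ‖u t x‖ₑ ^ 3) ^ (q / 3) :=
            ENNReal.rpow_le_rpow (l3cube_le_low_add_super hν hcl hLH hK θ ht') hq3
        _ ≤ (2 : ℝ≥0∞) ^ (q / 3) * ((ENNReal.ofReal (2 * E₀ * K * (T - t) ^ (-θ))) ^ (q / 3) + high t) :=
            add_rpow_le_two_rpow _ _ hq3
        _ = (2 : ℝ≥0∞) ^ (q / 3) * (low t + high t) := by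
            congr 2
            rw [hlow, ENNReal.ofReal_rpow_of_nonneg (mul_nonneg h2EK (Real.rpow_nonneg hs.le _)) hq3,
              Real.mul_rpow h2EK (Real.rpow_nonneg hs.le _), ← Real.rpow_mul hs.le]
            ring_nf
    have hlow_fin : ∫⁻ t in Ioo T₂ T, low t < ⊤ := lintegral_low_rpow_lt_top hT₂.2 hθ hq0 hq5
    calc ∫⁻ t in Ioo T₂ T, eLpNorm (u t) 3 volume ^ q
        ≤ ∫⁻ t in Ioo T₂ T, (2 : ℝ≥0∞) ^ (q / 3) * (low t + high t) :=
          setLIntegral_mono' measurableSet_Ioo hpt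
      _ = (2 : ℝ≥0∞) ^ (q / 3) * ((∫⁻ t in Ioo T₂ T, low t) + ∫⁻ t in Ioo T₂ T, high t) := by
          rw [lintegral_const_mul' _ _ (ENNReal.rpow_ne_top_of_nonneg hq3 ENNReal.ofNat_ne_top),
            lintegral_add_left hlow_meas]
      _ < ⊤ := by
          refine ENNReal.mul_lt_top (ENNReal.rpow_lt_top_of_nonneg hq3 ENNReal.ofNat_ne_top) ?_
          exact ENNReal.add_lt_top.2 ⟨hlow_fin, hfin⟩

/-- **The crux BY NAME ⟺ its super-Euler-speed localisation.**  For any fixed `K > 0`: `L3CascadeJaw` holds iff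
for every `q ∈ (4,5)` and every frame solution the `L³`-mass of the super-Euler-speed set
`{x : |u(t,x)| > K (T-t)^{-3/5}}` satisfies `∫_{T₂}^T (∫_{super} |u(t)|³)^{q/3} dt < ∞` on a final window. -/
theorem l3CascadeJaw_iff_superEuler {K : ℝ} (hK : 0 < K) :
    L3CascadeJaw ↔
      ∀ q : ℝ, 4 < q → q < 5 → ∀ (ν T : ℝ), 0 < ν → 0 < T →
        ∀ (u : ℝ → EuclideanSpace ℝ (Fin 3) → EuclideanSpace ℝ (Fin 3)) (p : ℝ → EuclideanSpace ℝ (Fin 3) → ℝ),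
          IsClassicalNSSolutionOn (Ico 0 T) ν 0 u p → IsLerayHopfOn T ν 0 (u 0) u →
          HasRapidSpatialDecay (u 0) →
          ∃ T₂ ∈ Ioo 0 T, (∫⁻ t in Ioo T₂ T,
            (∫⁻ x in {y | K * (T - t) ^ (-(3 / 5 : ℝ)) < ‖u t y‖}, ‖u t x‖ₑ ^ 3) ^ (q / 3)) < ⊤ := by
  unfold L3CascadeJaw
  constructor
  · intro h q hq4 hq5 ν T hν hT u p hcl hLH hdec
    exact (jawClauseAt_iff_superEuler hν hcl hLH hK.le le_rfl (by linarith) hq5).1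
      (h q hq4 hq5 ν T hν hT u p hcl hLH hdec)
  · intro h q hq4 hq5 ν T hν hT u p hcl hLH hdec
    exact (jawClauseAt_iff_superEuler hν hcl hLH hK.le le_rfl (by linarith) hq5).2
      (h q hq4 hq5 ν T hν hT u p hcl hLH hdec)

/-! ## §4  Corollaries: the sup Euler-speed law, and the Euler-weighted `L^p` family -/

/-- **Empty super-Euler set ⇒ the clause for every `q < 5`.**  If a frame solution obeys the sup-norm
Euler-speed law `|u(t,x)| ≤ K (T-t)^{-3/5}` on a final window, then `∫_{T₂}^T ‖u(t)‖₃^q dt < ∞` for every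
`0 ≤ q < 5` (the birth line's `stub_supRateToL3Rate`, here via the localisation with an empty super-level set). -/
theorem jawClauseAt_of_supEulerSpeedLaw {ν T : ℝ} (hν : 0 < ν) (hT : 0 < T)
    {u : ℝ → EuclideanSpace ℝ (Fin 3) → EuclideanSpace ℝ (Fin 3)} {p : ℝ → EuclideanSpace ℝ (Fin 3) → ℝ}
    (hcl : IsClassicalNSSolutionOn (Ico 0 T) ν 0 u p) (hLH : IsLerayHopfOn T ν 0 (u 0) u)
    {K T₁ : ℝ} (hK : 0 ≤ K) (hT₁ : T₁ < T)
    (hsup : ∀ t ∈ Ioo T₁ T, ∀ x, ‖u t x‖ ≤ K * (T - t) ^ (-(3 / 5 : ℝ)))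
    {q : ℝ} (hq0 : 0 ≤ q) (hq5 : q < 5) :
    ∃ T₂ ∈ Ioo 0 T, (∫⁻ t in Ioo T₂ T, eLpNorm (u t) 3 volume ^ q) < ⊤ := by
  refine (jawClauseAt_iff_superEuler hν hcl hLH hK (le_refl (3 / 5 : ℝ)) hq0 hq5).2 ?_
  set T₂ : ℝ := max T₁ (T / 2) with hT₂
  have hT₂mem : T₂ ∈ Ioo 0 T := ⟨lt_max_of_lt_right (by linarith), max_lt hT₁ (by linarith)⟩
  refine ⟨T₂, hT₂mem, ?_⟩
  have hempty : ∀ t ∈ Ioo T₂ T, {y | K * (T - t) ^ (-(3 / 5 : ℝ)) < ‖u t y‖} = ∅ := by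
    intro t ht
    have ht₁ : t ∈ Ioo T₁ T := ⟨(le_max_left _ _).trans_lt ht.1, ht.2⟩
    ext y
    simp only [mem_setOf_eq, mem_empty_iff_false, iff_false, not_lt]
    exact hsup t ht₁ y
  have hpt : ∀ t ∈ Ioo T₂ T,
      (∫⁻ x in {y | K * (T - t) ^ (-(3 / 5 : ℝ)) < ‖u t y‖}, ‖u t x‖ₑ ^ 3) ^ (q / 3) ≤ 1 := by
    intro t ht
    rw [hempty t ht, Measure.restrict_empty, lintegral_zero_measure]
    rcases (show 0 ≤ q / 3 by positivity).eq_or_lt with h0 | hpos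
    · rw [← h0, ENNReal.rpow_zero]
    · rw [ENNReal.zero_rpow_of_pos hpos]
      exact zero_le_one
  calc ∫⁻ t in Ioo T₂ T, (∫⁻ x in {y | K * (T - t) ^ (-(3 / 5 : ℝ)) < ‖u t y‖}, ‖u t x‖ₑ ^ 3) ^ (q / 3)
      ≤ ∫⁻ t in Ioo T₂ T, 1 := setLIntegral_mono' measurableSet_Ioo hpt
    _ < ⊤ := by rw [setLIntegral_const, one_mul, Real.volume_Ioo]; exact ENNReal.ofReal_lt_top

/-- **Sup Euler-speed law on the blow-up branch ⇒ `L3CascadeJaw` (BY NAME).**  If every frame solution that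
does not extend smoothly past `T` satisfies `|u(t,x)| ≤ K (T-t)^{-3/5}` on a final window (the birth stub
`stub_supEulerSpeedLaw` of the crux), then the crux holds: the birth line's composition as a tree theorem. -/
theorem l3CascadeJaw_of_supEulerSpeedLaw_blowup
    (h : ∀ (ν T : ℝ), 0 < ν → 0 < T →
      ∀ (u : ℝ → EuclideanSpace ℝ (Fin 3) → EuclideanSpace ℝ (Fin 3)) (p : ℝ → EuclideanSpace ℝ (Fin 3) → ℝ),
        IsClassicalNSSolutionOn (Ico 0 T) ν 0 u p → IsLerayHopfOn T ν 0 (u 0) u →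
        HasRapidSpatialDecay (u 0) → ¬ HasSmoothExtensionPast ν 0 u T →
        ∃ K : ℝ, 0 ≤ K ∧ ∃ T₁ < T, ∀ t ∈ Ioo T₁ T, ∀ x, ‖u t x‖ ≤ K * (T - t) ^ (-(3 / 5 : ℝ))) :
    L3CascadeJaw := by
  rw [l3CascadeJaw_iff_blowupBranch]
  intro q hq4 hq5 ν T hν hT u p hcl hLH hdec hblow
  obtain ⟨K, hK, T₁, hT₁, hsup⟩ := h ν T hν hT u p hcl hLH hdec hblow
  exact jawClauseAt_of_supEulerSpeedLaw hν hT hcl hLH hK hT₁ hsup (by linarith) hq5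

/-- **Euler-weighted `L^p` currency ⇒ the clause** (`p ≥ 3`).  If on a final window
`∫_{T₂}^T ((T-t)^{3(p-3)/5} ∫|u(t)|^p)^{q/3} dt < ∞`, then `∫ ‖u(t)‖₃^q dt < ∞` on a final window
(`0 ≤ q < 5`): on the super-Euler set `|u|³ ≤ λ^{3-p}|u|^p` with `λ = (T-t)^{-3/5}`, `λ^{3-p} = (T-t)^{3(p-3)/5}`.
(`p = 6` plus Sobolev `‖u‖₆² ≲ ∫|∇u|²` recovers the dissipation-axis node `δ ≲ (T-t)^{-γ}`, `γ < 4/5`.) -/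
theorem jawClauseAt_of_weightedLp {ν T : ℝ} (hν : 0 < ν)
    {u : ℝ → EuclideanSpace ℝ (Fin 3) → EuclideanSpace ℝ (Fin 3)} {p : ℝ → EuclideanSpace ℝ (Fin 3) → ℝ}
    (hcl : IsClassicalNSSolutionOn (Ico 0 T) ν 0 u p) (hLH : IsLerayHopfOn T ν 0 (u 0) u)
    {r : ℝ} (hr : 3 ≤ r) {q : ℝ} (hq0 : 0 ≤ q) (hq5 : q < 5)
    (hw : ∃ T₂ ∈ Ioo 0 T, (∫⁻ t in Ioo T₂ T,
      (ENNReal.ofReal ((T - t) ^ (3 * (r - 3) / 5)) * ∫⁻ x, ‖u t x‖ₑ ^ r) ^ (q / 3)) < ⊤) :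
    ∃ T₂ ∈ Ioo 0 T, (∫⁻ t in Ioo T₂ T, eLpNorm (u t) 3 volume ^ q) < ⊤ := by
  refine (jawClauseAt_iff_superEuler hν hcl hLH zero_le_one (le_refl (3 / 5 : ℝ)) hq0 hq5).2 ?_
  obtain ⟨T₂, hT₂, hfin⟩ := hw
  refine ⟨T₂, hT₂, lt_of_le_of_lt (setLIntegral_mono' measurableSet_Ioo fun t ht => ?_) hfin⟩
  have ht' : t ∈ Ico 0 T := ⟨(hT₂.1.trans ht.1).le, ht.2⟩
  have hs : 0 < T - t := sub_pos.2 ht.2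
  have hl : 0 < (1 : ℝ) * (T - t) ^ (-(3 / 5 : ℝ)) := by rw [one_mul]; exact Real.rpow_pos_of_pos hs _
  refine ENNReal.rpow_le_rpow ?_ (by positivity)
  calc ∫⁻ x in {y | 1 * (T - t) ^ (-(3 / 5 : ℝ)) < ‖u t y‖}, ‖u t x‖ₑ ^ 3
      ≤ ENNReal.ofReal ((1 * (T - t) ^ (-(3 / 5 : ℝ))) ^ (3 - r)) *
          ∫⁻ x in {y | 1 * (T - t) ^ (-(3 / 5 : ℝ)) < ‖u t y‖}, ‖u t x‖ₑ ^ r :=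
        setLIntegral_cube_le_rpow_mul_setLIntegral_rpow (measurable_velocity hcl ht') hl hr
    _ ≤ ENNReal.ofReal ((T - t) ^ (3 * (r - 3) / 5)) * ∫⁻ x, ‖u t x‖ₑ ^ r := by
        refine mul_le_mul' (le_of_eq ?_) (setLIntegral_le_lintegral _ _)
        rw [one_mul, ← Real.rpow_mul hs.le]
        congr 2
        ring

end Summit.NavierStokesRegularity.NavierStokesRegularity.Theorems.L3TimeExponentPincerJawSuperEuler

end
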